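import Summits.ABC.IUTFork.Cor312NaiveProvPinnedThm311
import Summits.ABC.IUTFork.Cor312NaiveProvSetting
import Summits.ABC.IUTFork.Cor312PinnedSetting
import Summits.ABC.IUTFork.Thm311ToCor312
import HarnessLib

/-!
# The PINNED naive model over ANY index skeleton, III: the pin-honest Cor. 3.12 setting (objects = exponents,
# glue READS the object)

Record-only file (D-0012) of the abc-iut cell (D-0067 adjudication, ADJUDICATION-SPEC §2 (G-PINNED)/(G3″);
support piece «G-NV-PROV-PINNED» = PR-2 × PROVENANCE, seat abc-iut-w4-d026 gen 3); TAKES NO SIDE on [IUTchIII]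
Cor. 3.12; introduces NO `Prop` fact: the definitions below are MODEL DATA.  Part III (of six: I Shells · II Thm311 · III Setting · IIIb Volumes · IV Operators · V Witness).  Over the
contentful Thm-3.11 instance of record `full1 p v_ℚ¹ c` of Part II (ANY index skeleton `T`, prime `p`, scale
`c`, the supported rational place `v_ℚ¹ := v_ℚ(v₁)` UNDER A BAD PLACE `v₁ ∈ 𝕍^bad`), this file builds
c312-7's verbatim `Cor312.Setting` with abc-iut-w4-d101's HONEST OBJECT SIDE (`Cor312PinnedSetting` p418585,
used verbatim: value monoids `ExpMonoid = q^ℕ` for the lgp-monoids and the q-side splitting monoids, objects of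
every Frobenioid = exponents `k : ℤ`, the object-forming algorithm of [IUTchIII] Prop. 3.7 (v) and the q-pilot
datum READ THE EXPONENT of the monoid element at the bad place `v₁`; `IsGeneratorUpToTorsion g → expOf g = 1`
is w4-d101's theorem, so Def. 3.8 (i)'s "ANY collection of generators up to torsion" is a genuine `∀`) and
GLUE FIELDS THAT READ THE OBJECT over every rational place:
* `thetaRegionOf m k j v_ℚ := B_{k·j²}` at the rational places UNDER A BAD PLACE (the ideal `q^{k·j²}𝒪` — the
  packet region, through the column-`(n,m)` Kummer isomorphism = gen 2's sign twist, which fixes cylinders, of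
  the exponent-`k` lgp-object at label `j`), and the integral structure `B_0 = 𝒪` at the rational places under
  no bad place (where a Θ-pilot object has no component: [IUTchIII] Def. 3.8 (i) "indexed by `v ∈ 𝕍^bad`");
* `qRegionOf k j v_ℚ := B_k` at the labels `j ∈ 𝔽_l^⋆` and the rational places under a bad place, `B_0`
  elsewhere (zero-label convention of w4-d101's `pinnedSetting`, p419465: neither pilot object has a label-`0`
  component and Cor. 3.12 never reads it; ONE region operator then serves both pins in Part IV).
PROVED: `thetaPilot = 1 = qPilot`; the Kummer images COMPUTED from the objects (`thetaRegion m j v_ℚ = B_{j²}` /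
`B_0`, `qRegion j v_ℚ = B_1` / `B_0`); possible images the SINGLETON of the Kummer image (the whole
(Ind1),(Ind2)-group fixes cylinders); hull = the image (no inflation); Kummer images admissible; c312-1's
OBJECT-LEVEL pilot law `PilotLink` (the third pin (pL) of p418935) and c312-11's `LinkGluing` hold CONTENTFULLY
(exponent objects, identity `q^ℕ ≅ q^ℕ` generator-to-generator — not the vacuous one-point instance of PR3-F2/C14);
the glue is not Team R's identified reading.  The two printed quantities (`−|log(q)| = −c`,
`−|log(Θ)| = stepVWeight(T)·(−c)`), `¬ Statement` and the bridge hypotheses are the proof-only Part IIIb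
(`Cor312NaiveProvPinnedVolumes`); the region OPERATOR, the q-pilot's Kummer datum and the pins are Part IV; the
countermodel at the provenance level of every initial Θ-datum is the proof-only Part V.
HONEST SCOPE: interface + provenance level; volumes at ONE supported rational place; regions are cylinders along
one packet coordinate; no judgement on print. [claim: Mochizuki2012, status: disputed] [cite: ScholzeStix2018, §2.2 pp. 9–10]
-/

noncomputable section

namespace Summit.ABC

namespace IUTFork

namespace Cor312Vol

namespace NaiveProv

open Thm311 Cor312 Cor312.IdentifiedNonVacuity Literature.IUT.LogThetaLattice PinnedWitness

variable {T : ThetaIndex} (p : ℕ) (v₁ : T.V) (hv₁ : v₁ ∈ T.Vbad) (c : ℝ)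

/-! ## C1. Rational places under a bad place; the exponents the glue reads -/

/-- "`v_ℚ` lies under a bad place": some `v ∈ 𝕍^bad` has `v_ℚ(v) = v_ℚ` (the rational places at which a Θ-pilot
object has components, [IUTchIII] Def. 3.8 (i)). [claim: Mochizuki2012, status: disputed] -/
def HasBad (vQ : T.VQ) : Prop := ∃ v ∈ T.Vbad, T.over v = vQ

omit hv₁ in
/-- The rational place under the chosen bad place lies under a bad place. [folklore] -/
theorem hasBad_over (hv₁ : v₁ ∈ T.Vbad) : HasBad (T.over v₁) := ⟨v₁, hv₁, rfl⟩

open scoped Classical in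
/-- The Θ-EXPONENT at `(j, v_ℚ)` of the exponent-`1` lgp-object: `j²` under a bad place, `0` elsewhere.
[claim: Mochizuki2012, status: disputed] -/
def tE (j : T.Label) (vQ : T.VQ) : ℤ := if HasBad vQ then jsq j else 0

open scoped Classical in
/-- The q-EXPONENT at `(j, v_ℚ)` of the exponent-`1` `△`-object: `1` at `j ∈ 𝔽_l^⋆` under a bad place, `0`
elsewhere. [claim: Mochizuki2012, status: disputed] -/
def qE (j : T.Label) (vQ : T.VQ) : ℤ := if j ≠ 0 ∧ HasBad vQ then 1 else 0

/-- Under a bad place the Θ-exponent at label `j` is `j²`. [folklore] -/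
theorem tE_of_hasBad {vQ : T.VQ} (h : HasBad vQ) (j : T.Label) : tE j vQ = jsq j := by
  classical
  exact if_pos h

/-- Away from the bad places the Θ-exponent is `0`. [folklore] -/
theorem tE_of_not_hasBad {vQ : T.VQ} (h : ¬ HasBad vQ) (j : T.Label) : tE j vQ = 0 := by
  classical
  exact if_neg h

/-- At the zero label the Θ-exponent is `0` (`0² = 0`). [folklore] -/
theorem tE_zero (vQ : T.VQ) : tE (0 : T.Label) vQ = 0 := by
  classical
  unfold tE jsq; split_ifs <;> simp

/-- Under a bad place the q-exponent at a nonzero label is `1`. [folklore] -/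
theorem qE_of_hasBad {vQ : T.VQ} (h : HasBad vQ) {j : T.Label} (hj : j ≠ 0) : qE j vQ = 1 := by
  classical
  exact if_pos ⟨hj, h⟩

/-- Away from the bad places the q-exponent is `0`. [folklore] -/
theorem qE_of_not_hasBad {vQ : T.VQ} (h : ¬ HasBad vQ) (j : T.Label) : qE j vQ = 0 := by
  classical
  exact if_neg fun h' => h h'.2

/-- At the zero label the q-exponent is `0`. [folklore] -/
theorem qE_zero (vQ : T.VQ) : qE (0 : T.Label) vQ = 0 := by
  classical
  exact if_neg fun h' => h'.1 rfl

/-! ## C2. The honest output of Prop. 3.7 and the pinned setting over the index skeleton -/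

omit hv₁ in
/-- `𝔽_l^⋆` is nonempty (`l⋆ ≥ 2`): the index `0`. [folklore] -/
theorem lstar_pos : 0 < T.lstar := lt_of_lt_of_le two_pos T.two_le_lstar

/-- **Output of [IUTchIII] Prop. 3.7 for the pinned model over `T`** (w4-d101's `pinSig`, index-generic): every
Frobenioid / strip is a point, OBJECTS are exponents `k : ℤ` (the object of exponent `k` of `𝒞^⊩_lgp ⊆ ∏_j 𝓕⊛ℝ_𝔪𝔬𝔡,j`
is the tuple `(q^{k·j²}𝒪)_j` of local fractional ideals; of `𝒞^⊩_△`, the ideal `q^k𝒪`), and the object-forming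
algorithm of (v) READS THE EXPONENT of the given element of the lgp-monoid at the bad place `v₁`.
[claim: Mochizuki2012, status: disputed] -/
def pinSig : GlobalLGPFrobenioidSignature T.lstar T.V (· ∈ T.Vbad) Unit (fun _ _ => Unit) (fun _ => ℤ) id Unit
    (fun _ _ => Unit) (fun _ _ => ExpMonoid) where
  FMOD := fun _ => ()
  Fmod := fun _ => ()
  Ffrak := fun _ => ()
  isoModMOD := fun _ => ()
  isoModFrak := fun _ => ()
  isoFrakMOD := fun _ => ()
  CLGP := ()
  Clgp := ()
  FLGP := ()
  Flgp := ()
  Fgau := ()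
  isoGauLGP := ()
  isoLGPlgp := ()
  isoCLGPlgp := ()
  embLGP := fun k _ => k
  embLgp := fun k _ => k
  embLGP_injective := fun a b h => by simpa using congrFun h ⟨0, lstar_pos⟩
  embLgp_injective := fun a b h => by simpa using congrFun h ⟨0, lstar_pos⟩
  objOfLgp := fun x => (expOf (x v₁ hv₁) : ℤ)
  objOfLGP := fun x => (expOf (x v₁ hv₁) : ℤ)
  objOfFrak := fun x _ => (expOf (x v₁ hv₁) : ℤ)
  objOfMOD := fun x _ => (expOf (x v₁ hv₁) : ℤ)

/-- **The PINNED SETTING of Cor. 3.12 over the index skeleton `T`** (over Part II's `full1 p v_ℚ(v₁) c`, column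
`n = 0`, hull frames the `p`-adic cylinders): the honest object side of w4-d101's `pinnedSetting` — lgp-monoids and
q-monoids `ExpMonoid`, splitting monoids everything with the generator `gen` (up to torsion; any other generator
has the same exponent), Prop. 3.7 output `pinSig`, q-pilot datum `q_v := gen` with object map the exponent at
`v₁` — and GLUE READING THE OBJECT: the `(n,m)`-Kummer image of the lgp-object of exponent `k` at `(j, v_ℚ)` is
`B_{k·j²}` under a bad place and `𝒪 = B_0` elsewhere; the image of the `△`-object of exponent `k` is `B_k` at
`j ∈ 𝔽_l^⋆` under a bad place and `𝒪` elsewhere. [claim: Mochizuki2012, status: disputed] -/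
def pinnedSetting : Setting (situationOf p (T.over v₁) c (thetaVec1 p)) where
  n := 0
  HT := ℤ × ℤ
  LogLink := fun _ _ => Unit
  IsFull := fun _ => True
  lattice :=
    { theater := fun n m => (n, m)
      distinct := fun p q h => by simpa using h
      logLink := fun _ _ => ()
      logLink_full := fun _ _ => trivial }
  Frd := Unit
  IsoF := fun _ _ => Unit
  Ob := fun _ => ℤ
  realify := id
  Strip := Unit
  IsoS := fun _ _ => Unit
  M := fun _ _ => ExpMonoid
  sig := pinSig v₁ hv₁
  split := { Msplit := fun _ _ => ⊤, exists_gen := fun _ _ => ⟨⟨gen, trivial⟩, top_gen_isGenerator⟩ }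
  ObΔ := ℤ
  N := fun _ _ => ExpMonoid
  qData :=
    { q := fun _ _ => gen
      q_gen := fun _ _ => gen_isGenerator
      objOf := fun x => (expOf (x v₁ hv₁) : ℤ) }
  frame := fun j vQ => pFrame p j vQ
  hul_adm := fun _ _ _ hH => by obtain ⟨k, rfl⟩ := hH; exact ⟨k, rfl⟩
  thetaRegionOf := fun _ k j vQ => pBall p j vQ (k * tE j vQ)
  qRegionOf := fun k j vQ => pBall p j vQ (k * qE j vQ)
  qRegion_mem := fun _ _ => ⟨_, rfl⟩
  qSupport_finite := fun _ =>
    GapWitnessProv.support_finite_of_ne (T.over v₁) fun vQ hvQ => vol_of_ne p (T.over v₁) c hvQ _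

variable [hp : Fact p.Prime]

/-! ## C3. The pilot objects and their Kummer images, COMPUTED -/

omit hp in
/-- **The Θ-pilot object is the lgp-object of exponent `1`** — for whichever generator up to torsion Def. 3.8 (i)
picks (w4-d101's `expOf_eq_one_of_isGenerator_top`). [folklore] -/
theorem pinnedSetting_thetaPilot : (pinnedSetting p v₁ hv₁ c).thetaPilot = (1 : ℤ) :=
  congrArg (Nat.cast : ℕ → ℤ)
    (expOf_eq_one_of_isGenerator_top (Classical.choose_spec ((pinnedSetting p v₁ hv₁ c).split.exists_gen v₁ hv₁)))

omit hp in
/-- **The q-pilot object is the `△`-object of exponent `1`** (`q_v = gen`). [folklore] -/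
theorem pinnedSetting_qPilot : (pinnedSetting p v₁ hv₁ c).qPilot = (1 : ℤ) := rfl

omit hp in
/-- The `(n,m)`-Kummer image of the Θ-pilot object at `(j, v_ℚ)` is `B_{tE j v_ℚ}` — COMPUTED from the object.
[folklore] -/
theorem pinnedSetting_thetaRegion (m : ℤ) (j : T.Label) (vQ : T.VQ) :
    (pinnedSetting p v₁ hv₁ c).thetaRegion m j vQ = pBall p j vQ (tE j vQ) := by
  unfold Setting.thetaRegion
  rw [pinnedSetting_thetaPilot]
  show pBall p j vQ ((1 : ℤ) * tE j vQ) = _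
  rw [one_mul]

omit hp in
/-- Under a bad place the Kummer image of the Θ-pilot object at label `j` is `B_{j²} = q^{j²}𝒪`. [folklore] -/
theorem pinnedSetting_thetaRegion_of_hasBad (m : ℤ) (j : T.Label) {vQ : T.VQ} (h : HasBad vQ) :
    (pinnedSetting p v₁ hv₁ c).thetaRegion m j vQ = pBall p j vQ (jsq j) := by
  rw [pinnedSetting_thetaRegion, tE_of_hasBad h]

omit hp in
/-- The image of the q-pilot object at `(j, v_ℚ)` is `B_{qE j v_ℚ}` — computed from the object. [folklore] -/
theorem pinnedSetting_qRegion (j : T.Label) (vQ : T.VQ) :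
    (pinnedSetting p v₁ hv₁ c).qRegion j vQ = pBall p j vQ (qE j vQ) := by
  unfold Setting.qRegion
  rw [pinnedSetting_qPilot]
  show pBall p j vQ ((1 : ℤ) * qE j vQ) = _
  rw [one_mul]

omit hp in
/-- Under a bad place, at a label of `𝔽_l^⋆`, the image of the q-pilot object is `B_1 = q·𝒪`. [folklore] -/
theorem pinnedSetting_qRegion_of_hasBad {j : T.Label} (hj : j ≠ 0) {vQ : T.VQ} (h : HasBad vQ) :
    (pinnedSetting p v₁ hv₁ c).qRegion j vQ = pBall p j vQ 1 := by
  rw [pinnedSetting_qRegion, qE_of_hasBad h hj]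

omit hp in
/-- The (Ind3)-enlarged region is the Kummer image itself (no `m`-drift: the Kummer twist is a sign). [folklore] -/
theorem pinnedSetting_thetaRegion3 (j : T.Label) (vQ : T.VQ) :
    (pinnedSetting p v₁ hv₁ c).thetaRegion3 j vQ = pBall p j vQ (tE j vQ) := by
  show (⋃ m : ℤ, (pinnedSetting p v₁ hv₁ c).thetaRegion m j vQ) = _
  simp_rw [pinnedSetting_thetaRegion]
  exact Set.iUnion_const _

omit hp in
/-- **The possible images of the Θ-pilot object are EXACTLY the singleton of its Kummer image**: every element of
the (Ind1),(Ind2)-group acts on the packet coordinate by signs and fixes cylinders (gen 2's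
`image_pBall_of_mem_closure`). [folklore] -/
theorem pinnedSetting_mem_possibleImages_iff (j : T.Label) (vQ : T.VQ) (U : Set ((signShells T).Packet j vQ)) :
    U ∈ (pinnedSetting p v₁ hv₁ c).possibleImages j vQ ↔ U = pBall p j vQ (tE j vQ) := by
  constructor
  · rintro ⟨Φ, hΦ, rfl⟩
    rw [pinnedSetting_thetaRegion3]
    exact image_pBall_of_mem_closure p hΦ j vQ _
  · rintro rfl
    rw [← pinnedSetting_thetaRegion3]
    exact (pinnedSetting p v₁ hv₁ c).thetaRegion3_mem_possibleImages j vQ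

omit hp in
/-- The family of possible images is the singleton `{B_{tE}}`. [folklore] -/
theorem pinnedSetting_possibleImages (j : T.Label) (vQ : T.VQ) :
    (pinnedSetting p v₁ hv₁ c).possibleImages j vQ = {pBall p j vQ (tE j vQ)} :=
  Set.ext fun U => by rw [pinnedSetting_mem_possibleImages_iff, Set.mem_singleton_iff]

omit hp in
/-- The union of the possible images is the Kummer image. [folklore] -/
theorem pinnedSetting_sUnion_possibleImages (j : T.Label) (vQ : T.VQ) :
    ⋃₀ (pinnedSetting p v₁ hv₁ c).possibleImages j vQ = pBall p j vQ (tE j vQ) := by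
  rw [pinnedSetting_possibleImages, Set.sUnion_singleton]

omit hp in
/-- **The holomorphic hull `^{n,∘}𝒰_{j,v_ℚ}` of the union of the possible images is the Kummer image itself** (no
inflation in this frame). [folklore] -/
theorem pinnedSetting_thetaHull (j : T.Label) (vQ : T.VQ) :
    (pinnedSetting p v₁ hv₁ c).thetaHull j vQ = pBall p j vQ (tE j vQ) := by
  show (pFrame p j vQ).hull (⋃₀ (pinnedSetting p v₁ hv₁ c).possibleImages j vQ) = _
  rw [pinnedSetting_sUnion_possibleImages, pFrame_hull_pBall]

/-- Every union of possible images admits its hull. [folklore] -/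
theorem pinnedSetting_hullDefined (j : T.Label) (vQ : T.VQ) : (pinnedSetting p v₁ hv₁ c).HullDefined j vQ := by
  show (pFrame p j vQ).IsBounded (⋃₀ (pinnedSetting p v₁ hv₁ c).possibleImages j vQ) ∧
    (pFrame p j vQ).HasHull (⋃₀ (pinnedSetting p v₁ hv₁ c).possibleImages j vQ)
  rw [pinnedSetting_sUnion_possibleImages]
  exact pFrame_bounded_hasHull p j vQ _

/-! ## C4. Admissibility, the object-level pilot law, not the identified reading -/

omit hp in
/-- Every Kummer image of the Θ-pilot object is admissible (a cylinder). [folklore] -/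
theorem pinnedSetting_thetaRegionsAdm : ThetaRegionsAdm (pinnedSetting p v₁ hv₁ c) :=
  fun m _ vQ => ⟨_, pinnedSetting_thetaRegion p v₁ hv₁ c m _ vQ⟩

/-- **c312-11's OBJECT-level Θ×μ_LGP-link gluing, INSTANTIATED CONTENTFULLY** (Step (xi-a), p. 181 l. 33–44; w4-d101's
`pinnedLinkGluing`, index-generic): the identity of exponents (the full poly-isomorphism `q^ℕ ≅ q^ℕ` carries
generator to generator) carries the Θ-pilot object (exponent `1`) to the q-pilot object (exponent `1`).
[claim: Mochizuki2012, status: disputed] -/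
def pinnedLinkGluing : LinkGluing (pinnedSetting p v₁ hv₁ c) where
  linkMap := fun k => k
  link_thetaPilot := by rw [pinnedSetting_thetaPilot]; rfl

omit hp in
/-- **The third pin (pL) holds contentfully**: c312-1's object-level `PilotLink` (the identity of exponent objects;
on exponent objects, not on a one-point object type). [folklore] -/
theorem pinnedSetting_pilotLink : Thm311ToCor312.PilotLink (pinnedSetting p v₁ hv₁ c) :=
  ⟨Equiv.refl ℤ, by rw [pinnedSetting_thetaPilot]; rfl⟩

/-- **The glue is NOT Team R's identified-copies reading**: under the bad place `v₁`, at the label `l⋆ ≥ 2`,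
the Θ-image `B_{l⋆²}` differs from the q-image `B_1`. [folklore] -/
theorem pinnedSetting_not_identifiedReading : ¬ (pinnedSetting p v₁ hv₁ c).IdentifiedReading := by
  intro h
  have h2 := h.kummer 0 (Fin.last T.lstar) (T.over v₁)
  rw [pinnedSetting_thetaRegion_of_hasBad p v₁ hv₁ c 0 _ (hasBad_over v₁ hv₁),
    pinnedSetting_qRegion_of_hasBad p v₁ hv₁ c (fun h0 => ?_) (hasBad_over v₁ hv₁)] at h2
  · have h3 := pBall_injective p (Fin.last T.lstar : T.Label) (T.over v₁) h2
    have hl := T.two_le_lstar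
    simp [jsq] at h3
    omega
  · have hl := T.two_le_lstar
    have := congrArg Fin.val h0
    simp at this
    omega


end NaiveProv

end Cor312Vol

end IUTFork

end Summit.ABC

end
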